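/-
Copyright (c) 2026. All rights reserved.
Released under Apache 2.0 license as described in the file LICENSE.
-/
import Literature.MathematicalPhysics.QuantumLattice.HubbardNNNHoppingThermodynamicLimit
import HarnessLib

/-!
# The any-parity tiling bound for the `t–t'` energy density

Topic `MathematicalPhysics/QuantumLattice`, family `hubbard`. One elementary consequence of the
thermodynamic-limit theory of `energyDensityTT' t t' U n` (`HubbardNNNHoppingThermodynamicLimit.lean`,
Ruelle (1969) §3.3) that the `t' = 0` tree already has for `energyDensity2D`
(`HubbardBoxSectorEnergyBounds.lean`: `energyDensity2D_le_of_lt`) and that the quasi-free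
(Lieb variational principle) upper bounds for the `t–t'` model consume: the tree's tiling bound
`energyDensityTT'_le` needs an EVEN particle number `2m`; here

* `energyDensityTT'_le_of_lt` / `energyDensityTT'_le_torus_of_lt` — **tiling bound, any parity**: for
  `U ≥ 0`, `ℓ ≥ 1` and every particle number `N < 2ℓ²` (odd allowed),
  `e(t,t',U; N/ℓ²) ≤ E_{ℓ×ℓ}(N)/ℓ² + (16|t| + 32|t'|)/ℓ` — tile the `2kℓ`-tori by `(2k)²` copies, each
  carrying `N` particles (`groundEnergy_hubbardRectTorusTT'_square_tiling`; `(2k)²N = N_{2kℓ}(N/ℓ²)`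
  exactly), and let `k → ∞` through `tendsto_energyDensityTT'`.

(The supporting line of the convex profile and its filled-band endpoint are already the tree's
`exists_supporting_line_energyDensityTT'` and `supporting_line_energyDensityTT'_at_two_le`.)
Everything is proved; no definitions; no named facts.

## Mathlib / tree search

Tree (REUSED): `groundEnergy_hubbardRectTorusTT'_square_tiling`, `tendsto_energyDensityTT'`, `rectN`,
`groundEnergy_hubbardTorusTT'_eq_rect`. `lean search 'energyDensityTT._le_of_lt'`: only the `t' = 0`
version `energyDensity2D_le_of_lt` (`HubbardBoxSectorEnergyBounds.lean`), whose proof this file copies.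

## References

* D. Ruelle, *Statistical Mechanics: Rigorous Results* (Benjamin, 1969), §3.3. [Ruelle1969]
-/

noncomputable section

open Filter Topology Set

namespace Literature.MathematicalPhysics.QuantumLattice

namespace ThermodynamicLimit

/-! ### The tiling bound for all particle numbers -/

/-- **Tiling bound, any parity, `t–t'` model**: for `U ≥ 0`, `ℓ ≥ 1` and every `N < 2ℓ²`,
`e(t,t',U; N/ℓ²) ≤ E_{ℓ×ℓ}(N)/ℓ² + (16|t| + 32|t'|)/ℓ` — tile the `2kℓ × 2kℓ` torus by `(2k)²` copies
of the `ℓ × ℓ` torus each carrying `N` particles (`(2k)² N = N_{2kℓ}(N/ℓ²)` exactly, no rounding)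
and let `k → ∞`. [cite: Ruelle1969, §3.3] -/
theorem energyDensityTT'_le_of_lt (t t' : ℝ) {U : ℝ} (hU : 0 ≤ U) {ℓ : ℕ} (hℓ : 1 ≤ ℓ) {N : ℕ}
    (hN : N < 2 * (ℓ * ℓ)) :
    energyDensityTT' t t' U ((N : ℝ) / (ℓ : ℝ) ^ 2) ≤
      groundEnergy (hubbardRectTorusTT' ℓ ℓ t t' U) N / (ℓ : ℝ) ^ 2 + (16 * |t| + 32 * |t'|) / ℓ := by
  set n : ℝ := (N : ℝ) / (ℓ : ℝ) ^ 2 with hn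
  have hℓpos : (0 : ℝ) < ℓ := by exact_mod_cast hℓ
  have hℓ2 : (0 : ℝ) < (ℓ : ℝ) ^ 2 := by positivity
  have hn0 : 0 ≤ n := by positivity
  have hn2 : n < 2 := by
    rw [hn, div_lt_iff₀ hℓ2]
    have : (N : ℝ) < 2 * (ℓ * ℓ : ℕ) := by exact_mod_cast hN
    push_cast at this; nlinarith
  have ht0 : 0 ≤ |t| := abs_nonneg t
  have ht'0 : 0 ≤ |t'| := abs_nonneg t'
  -- the subsequence `L_m = 2(m+1) ℓ`
  set K : ℕ → ℕ := fun m => 2 * (m + 1) with hK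
  have hrect : ∀ m, rectN n (K m * ℓ) = K m ^ 2 * N := by
    intro m
    rw [rectN]
    have : n * ((K m * ℓ : ℕ) : ℝ) ^ 2 / 2 = ((2 * N * (m + 1) ^ 2 : ℕ) : ℝ) := by
      rw [hn, hK]; push_cast; field_simp
    rw [this, Nat.floor_natCast, hK]; ring
  have htile : ∀ m, groundEnergy (hubbardRectTorusTT' (K m * ℓ) (K m * ℓ) t t' U) (rectN n (K m * ℓ)) ≤
      (K m : ℝ) ^ 2 * groundEnergy (hubbardRectTorusTT' ℓ ℓ t t' U) N +
        (16 * |t| + 32 * |t'|) * ℓ * (K m) ^ 2 := by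
    intro m
    have h := groundEnergy_hubbardRectTorusTT'_square_tiling ℓ t t' U (2 * m + 1) (fun _ _ => N)
      (fun _ _ => hN.le)
    have hKm : 2 * m + 1 + 1 = K m := by simp only [hK]; ring
    simp only [Finset.sum_const, Finset.card_univ, Fintype.card_fin, smul_eq_mul, nsmul_eq_mul] at h
    rw [hKm] at h
    have hmul : K m * (K m * N) = K m ^ 2 * N := by ring
    rw [hmul] at h
    rw [hrect m]
    push_cast at h
    have hKr : ((K m : ℕ) : ℝ) = 2 * (m : ℝ) + 2 := by simp only [hK]; push_cast; ring
    rw [hKr] at h ⊢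
    have hextra : 0 ≤ (16 * |t| + 32 * |t'|) * (ℓ : ℝ) * (2 * m + 2) := by positivity
    have hid : (2 * (m : ℝ) + 2) ^ 2 * groundEnergy (hubbardRectTorusTT' ℓ ℓ t t' U) N +
        (16 * |t| + 32 * |t'|) * ℓ * (2 * (m : ℝ) + 2) ^ 2 =
        (2 * (m : ℝ) + 2) * ((2 * (m : ℝ) + 2) * groundEnergy (hubbardRectTorusTT' ℓ ℓ t t' U) N) +
          (16 * |t| + 32 * |t'|) * ℓ * (2 * m + 1) * (2 * m + 1 + 1) +
            (16 * |t| + 32 * |t'|) * ℓ * (2 * m + 2) := by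
      ring
    rw [hid]
    linarith
  -- divide by `L_m²` and pass to the limit along the subsequence
  have hlim := (tendsto_energyDensityTT' t t' hU hn0 hn2).comp
    (tendsto_atTop_mono (fun m => by show m ≤ K m * ℓ; rw [hK]; nlinarith) tendsto_id)
  refine le_of_tendsto hlim (Eventually.of_forall fun m => ?_)
  have hKpos : (0 : ℝ) < K m := by rw [hK]; positivity
  have hL2 : (0 : ℝ) < ((K m * ℓ : ℕ) : ℝ) ^ 2 := by positivity
  rw [Function.comp_apply, div_le_iff₀ hL2]
  calc _ ≤ (K m : ℝ) ^ 2 * groundEnergy (hubbardRectTorusTT' ℓ ℓ t t' U) N +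
        (16 * |t| + 32 * |t'|) * ℓ * (K m) ^ 2 := htile m
    _ = _ := by push_cast; field_simp

/-- The any-parity tiling bound read on the square torus `hubbardTorusTT' L`:
`e(t,t',U; N/L²) ≤ E_{(ℤ/Lℤ)²}(N)/L² + (16|t| + 32|t'|)/L` for `U ≥ 0`, `L ≥ 1`, `N < 2L²`.
[cite: Ruelle1969, §3.3] -/
theorem energyDensityTT'_le_torus_of_lt (t t' : ℝ) {U : ℝ} (hU : 0 ≤ U) {L : ℕ} (hL : 1 ≤ L)
    {N : ℕ} (hN : N < 2 * (L * L)) :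
    energyDensityTT' t t' U ((N : ℝ) / (L : ℝ) ^ 2) ≤
      groundEnergy (hubbardTorusTT' L t t' U) N / (L : ℝ) ^ 2 + (16 * |t| + 32 * |t'|) / L := by
  rw [groundEnergy_hubbardTorusTT'_eq_rect]
  exact energyDensityTT'_le_of_lt t t' hU hL hN

end ThermodynamicLimit

end Literature.MathematicalPhysics.QuantumLattice
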